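import Literature.AlgebraicGeometry.Frobenioids.Prop53Sub
import HarnessLib

/-!
# Frobenioids I, Corollary 5.4: the STRONG 1-uniqueness clause at THE data — reduction to a
# one-Frobenioid rigidity statement (sub-DAG row C54/L07-strong)

Mochizuki, *The geometry of Frobenioids I: the general theory*, Kyushu J. Math. **62** (2008) 293–400,
Corollary 5.4, kurims p. 104 ll. 1–9: "there exists a 1-unique functor `Ψ^rlf : C₁^rlf → C₂^rlf` that fits into
a 1-commutative diagram […]". [cite: MochizukiFrdI2008, Cor. 5.4 p.104]

The typed schema `PreFrobenioid.Cor54` (`FrobenioidRealification.lean`, seat abc-iut-L1-t5) renders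
"1-unique" by the STRONG clause `∀ Ψ', Nonempty (ι₁ ⋙ Ψ' ≅ Ψ ⋙ ι₂) → Nonempty (Ψ' ≅ Ψ^rlf)` (every functor
fitting the square is isomorphic to `Ψ^rlf`); the honest form of record is `FrdI.Cor54Sub.OneUniqueData`
(PROVED, `Cor54SubOneUniqueProofs.lean`). PROOF-ONLY file (seat abc-iut-w5-d227, L1-lead R105c (2); cell
sub-DAG `plan/L1/SUBDAG-FrdI-Prop53-Cor54.md` row C54/L07-strong, AT THE DATA `ι_i := FrdI.Prop53Sub.iotaRlf`):
pure category theory reducing the strong clause to a RIGIDITY statement about ONE realification.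

* `FrdI.Cor54Sub.nonempty_iso_of_isoWhiskerLeft` — whiskering on the left by a FULL, ESSENTIALLY SURJECTIVE
  functor reflects natural isomorphisms: `G ⋙ T ≅ G ⋙ T' ⟹ T ≅ T'` (generic);
* `FrdI.Cor54Sub.strongUnique_of_rigidAlong'` — generic: if `Ψ^rlf` is an equivalence fitting a square
  `ι₁ ⋙ Ψ^rlf ≅ Ψ ⋙ ι₂` and EVERY endofunctor `T` of the source with `ι₁ ⋙ T ≅ ι₁` is `≅ 𝟭` ("rigidity along
  `ι₁`"), then every `Ψ'` fitting the square is `≅ Ψ^rlf`;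
* `FrdI.Cor54Sub.strongUnique_of_rigidAlong` — the same AT THE DATA of Cor. 5.4 (`FrdI.Cor54Sub.Square`, THE
  realifications `PreFrobenioid.rlf F_i hΦ_i`, THE vertical arrows `FrdI.Prop53Sub.iotaRlf F_i hΦ_i e_i`);
* `FrdI.Cor54Sub.rigidAlong_iota_iff_rigidAlong_untrToRlf` — since `C^istr → C^un-tr` is full and essentially
  surjective (Def. 3.1 (iv)) and the comparison `e` is an equivalence, rigidity along `ι = toUntr ⋙ e ⋙ untrToRlf`
  is EQUIVALENT to rigidity along the model-level realification functor `PreFrobenioid.untrToRlf F hΦ`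
  (model of `(Φ, Φ^birat)` → model of `(Φ^rlf, ℝ · Φ^birat)`).

SCOPE (honest): the core rigidity `∀ T, Nonempty (untrToRlf ⋙ T ≅ untrToRlf) → Nonempty (T ≅ 𝟭 _)` is NOT
proved here; it is the remaining content of the strong clause (it needs the "rationally standard" hypothesis
of Cor. 5.4 — it fails for the model of `(ℝ≥0, 0)` over a point via the floor functor). No definitions, no
new `Prop` facts; nothing here bears on [IUTchIII] Cor. 3.12.
-/

noncomputable section

namespace Literature.AlgebraicGeometry.Frobenioids

open CategoryTheory Opposite

universe w v v' u u' v₁ v₁' u₁ u₁' v₂ v₂' u₂ u₂'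

namespace FrdI.Cor54Sub

/-! ### Generic category theory -/

section Generic

variable {A : Type*} [Category A] {B : Type*} [Category B] {E : Type*} [Category E]

/-- **Whiskering on the left by a full, essentially surjective functor reflects natural isomorphisms**:
`G ⋙ T ≅ G ⋙ T'` implies `T ≅ T'` (components transported along `G.objObjPreimageIso`, naturality through
`G`-preimages of arrows). [cite: MochizukiFrdI2008, Cor. 5.4 p.104] -/
theorem nonempty_iso_of_isoWhiskerLeft (G : A ⥤ B) [G.Full] [G.EssSurj] {T T' : B ⥤ E}
    (α : G ⋙ T ≅ G ⋙ T') : Nonempty (T ≅ T') := by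
  refine ⟨NatIso.ofComponents
    (fun Y => T.mapIso (G.objObjPreimageIso Y).symm ≪≫ α.app (G.objPreimage Y) ≪≫
      T'.mapIso (G.objObjPreimageIso Y)) ?_⟩
  intro Y Y' g
  -- a `G`-preimage of `e_Y ≫ g ≫ e_{Y'}⁻¹`
  let h : G.objPreimage Y ⟶ G.objPreimage Y' :=
    G.preimage ((G.objObjPreimageIso Y).hom ≫ g ≫ (G.objObjPreimageIso Y').inv)
  have hh : G.map h = (G.objObjPreimageIso Y).hom ≫ g ≫ (G.objObjPreimageIso Y').inv := G.map_preimage _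
  have hg : g = (G.objObjPreimageIso Y).inv ≫ G.map h ≫ (G.objObjPreimageIso Y').hom := by
    rw [hh]; simp
  have hnat : T.map (G.map h) ≫ α.hom.app (G.objPreimage Y') =
      α.hom.app (G.objPreimage Y) ≫ T'.map (G.map h) := α.hom.naturality h
  simp only [Iso.trans_hom, Functor.mapIso_hom, Iso.symm_hom, Iso.app_hom, Category.assoc]
  rw [hg]
  simp only [Functor.map_comp, Category.assoc, Iso.map_hom_inv_id_assoc]
  change T.map (G.objObjPreimageIso Y).inv ≫ T.map (G.map h) ≫ α.hom.app (G.objPreimage Y') ≫ _ = _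
  rw [reassoc_of% hnat]
  erw [Category.assoc, Iso.map_hom_inv_id_assoc]
  rfl

/-- If `G ⋙ T ≅ G` forces `T ≅ 𝟭` (rigidity along `G`) and `G'` is `G` followed by nothing — bookkeeping form used
below: rigidity along `G ⋙ H` follows from rigidity along `H` when `G` is full and essentially surjective.
[cite: MochizukiFrdI2008, Cor. 5.4 p.104] -/
theorem rigidAlong_comp_of_full_essSurj (G : A ⥤ B) [G.Full] [G.EssSurj] (H : B ⥤ E)
    (hrig : ∀ T : E ⥤ E, Nonempty (H ⋙ T ≅ H) → Nonempty (T ≅ 𝟭 E)) :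
    ∀ T : E ⥤ E, Nonempty ((G ⋙ H) ⋙ T ≅ G ⋙ H) → Nonempty (T ≅ 𝟭 E) := by
  rintro T ⟨θ⟩
  refine hrig T (nonempty_iso_of_isoWhiskerLeft G ?_)
  exact (Functor.associator G H T).symm ≪≫ θ

/-- Conversely rigidity along `G ⋙ H` gives rigidity along `H` (whisker the hypothesis by `G`).
[cite: MochizukiFrdI2008, Cor. 5.4 p.104] -/
theorem rigidAlong_of_rigidAlong_comp (G : A ⥤ B) (H : B ⥤ E)
    (hrig : ∀ T : E ⥤ E, Nonempty ((G ⋙ H) ⋙ T ≅ G ⋙ H) → Nonempty (T ≅ 𝟭 E)) :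
    ∀ T : E ⥤ E, Nonempty (H ⋙ T ≅ H) → Nonempty (T ≅ 𝟭 E) := by
  rintro T ⟨θ⟩
  exact hrig T ⟨Functor.associator G H T ≪≫ Functor.isoWhiskerLeft G θ⟩

variable {C₁ : Type*} [Category C₁] {C₂ : Type*} [Category C₂] {R₁ : Type*} [Category R₁]
  {R₂ : Type*} [Category R₂]

/-- **Strong 1-uniqueness from rigidity along `ι₁` (generic form).** If `Ψ^rlf : R₁ ⥤ R₂` is an equivalence
with `ι₁ ⋙ Ψ^rlf ≅ Ψ ⋙ ι₂`, and every endofunctor `T` of `R₁` with `ι₁ ⋙ T ≅ ι₁` is isomorphic to the identity,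
then EVERY `Ψ' : R₁ ⥤ R₂` with `ι₁ ⋙ Ψ' ≅ Ψ ⋙ ι₂` is isomorphic to `Ψ^rlf`: apply rigidity to
`T := Ψ' ⋙ (Ψ^rlf)⁻¹`. [cite: MochizukiFrdI2008, Cor. 5.4 p.104] -/
theorem strongUnique_of_rigidAlong' (ι₁ : C₁ ⥤ R₁) (ι₂ : C₂ ⥤ R₂) (Ψ : C₁ ⥤ C₂) (Ψrlf : R₁ ⥤ R₂)
    [Ψrlf.IsEquivalence] (hsq : Nonempty (ι₁ ⋙ Ψrlf ≅ Ψ ⋙ ι₂))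
    (hrig : ∀ T : R₁ ⥤ R₁, Nonempty (ι₁ ⋙ T ≅ ι₁) → Nonempty (T ≅ 𝟭 R₁))
    (Ψ' : R₁ ⥤ R₂) (hsq' : Nonempty (ι₁ ⋙ Ψ' ≅ Ψ ⋙ ι₂)) : Nonempty (Ψ' ≅ Ψrlf) := by
  obtain ⟨σ⟩ := hsq
  obtain ⟨σ'⟩ := hsq'
  let T : R₁ ⥤ R₁ := Ψ' ⋙ Ψrlf.inv
  -- `ι₁ ⋙ T ≅ ι₁`
  have hT : Nonempty (ι₁ ⋙ T ≅ ι₁) :=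
    ⟨(Functor.associator ι₁ Ψ' Ψrlf.inv).symm ≪≫ Functor.isoWhiskerRight (σ' ≪≫ σ.symm) Ψrlf.inv ≪≫
      Functor.associator ι₁ Ψrlf Ψrlf.inv ≪≫ Functor.isoWhiskerLeft ι₁ Ψrlf.asEquivalence.unitIso.symm ≪≫
      ι₁.rightUnitor⟩
  obtain ⟨τ⟩ := hrig T hT
  -- `Ψ' ≅ (Ψ' ⋙ Ψrlf⁻¹) ⋙ Ψrlf ≅ 𝟭 ⋙ Ψrlf ≅ Ψrlf`
  exact ⟨Ψ'.rightUnitor.symm ≪≫ Functor.isoWhiskerLeft Ψ' Ψrlf.asEquivalence.counitIso.symm ≪≫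
    (Functor.associator Ψ' Ψrlf.inv Ψrlf).symm ≪≫ Functor.isoWhiskerRight τ Ψrlf ≪≫ Ψrlf.leftUnitor⟩

end Generic

/-! ### At THE data of Corollary 5.4 -/

section AtTheData

variable {D₁ : Type u₁'} [Category.{v₁'} D₁] {Φ₁ : D₁ᵒᵖ ⥤ CommMonCat.{w}}
  {C₁ : Type u₁} [Category.{v₁} C₁] {F₁ : C₁ ⥤ ElemFrobenioid Φ₁} (hΦ₁ : PreFrobenioid.IsPerfFactorialOn Φ₁)
  {D₂ : Type u₂'} [Category.{v₂'} D₂] {Φ₂ : D₂ᵒᵖ ⥤ CommMonCat.{w}}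
  {C₂ : Type u₂} [Category.{v₂} C₂] {F₂ : C₂ ⥤ ElemFrobenioid Φ₂} (hΦ₂ : PreFrobenioid.IsPerfFactorialOn Φ₂)
  (Ψistr : (PreFrobenioidData.ofFunctor Φ₁ F₁).Istr ⥤ (PreFrobenioidData.ofFunctor Φ₂ F₂).Istr)
  (e₁ : (PreFrobenioidData.ofFunctor Φ₁ F₁).Untr ≌ PreFrobenioid.untrModel F₁)
  (e₂ : (PreFrobenioidData.ofFunctor Φ₂ F₂).Untr ≌ PreFrobenioid.untrModel F₂)
  (Ψrlf : PreFrobenioid.rlf F₁ hΦ₁ ⥤ PreFrobenioid.rlf F₂ hΦ₂)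

/-- **Cor. 5.4, strong 1-uniqueness AT THE DATA, from rigidity along `ι₁`.** With THE vertical arrows
`ι_i = FrdI.Prop53Sub.iotaRlf F_i hΦ_i e_i : C_i^istr → C_i^rlf` of Prop. 5.3 and a functor `Ψ^rlf` which is an
equivalence fitting the square of Cor. 5.4 (`FrdI.Cor54Sub.Square`, row C54/L06; equivalence = row C54/L05): IF
every endofunctor `T` of `C₁^rlf` with `ι₁ ⋙ T ≅ ι₁` is `≅ 𝟭`, THEN every functor `Ψ' : C₁^rlf → C₂^rlf` fitting
the same square is `≅ Ψ^rlf` — the as-typed clause of `PreFrobenioid.Cor54`, at the data.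
[cite: MochizukiFrdI2008, Cor. 5.4 p.104] -/
theorem strongUnique_of_rigidAlong [Ψrlf.IsEquivalence] (hsq : Square hΦ₁ hΦ₂ Ψistr e₁ e₂ Ψrlf)
    (hrig : ∀ T : PreFrobenioid.rlf F₁ hΦ₁ ⥤ PreFrobenioid.rlf F₁ hΦ₁,
      Nonempty (FrdI.Prop53Sub.iotaRlf F₁ hΦ₁ e₁ ⋙ T ≅ FrdI.Prop53Sub.iotaRlf F₁ hΦ₁ e₁) →
        Nonempty (T ≅ 𝟭 _))
    (Ψ' : PreFrobenioid.rlf F₁ hΦ₁ ⥤ PreFrobenioid.rlf F₂ hΦ₂) (hsq' : Square hΦ₁ hΦ₂ Ψistr e₁ e₂ Ψ') :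
    Nonempty (Ψ' ≅ Ψrlf) :=
  strongUnique_of_rigidAlong' _ _ Ψistr Ψrlf hsq hrig Ψ' hsq'

variable {D : Type u'} [Category.{v'} D] {Φ : Dᵒᵖ ⥤ CommMonCat.{w}} {C : Type u} [Category.{v} C]
  {F : C ⥤ ElemFrobenioid Φ} (hΦ : PreFrobenioid.IsPerfFactorialOn Φ)
  (e : (PreFrobenioidData.ofFunctor Φ F).Untr ≌ PreFrobenioid.untrModel F)

/-- **Rigidity along `ι` ⟺ rigidity along the model-level realification functor `untrToRlf`.** THE vertical
arrow of Prop. 5.3 is `ι = toUntr ⋙ e ⋙ untrToRlf` with `toUntr : C^istr → C^un-tr` full and essentially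
surjective (Def. 3.1 (iv)) and `e` the comparison equivalence `C^un-tr ≌` model of `(Φ, Φ^birat)`; whiskering by
the full, essentially surjective `toUntr ⋙ e` reflects natural isomorphisms. [cite: MochizukiFrdI2008, Prop. 5.3 p.103] -/
theorem rigidAlong_iota_iff_rigidAlong_untrToRlf :
    (∀ T : PreFrobenioid.rlf F hΦ ⥤ PreFrobenioid.rlf F hΦ,
        Nonempty (FrdI.Prop53Sub.iotaRlf F hΦ e ⋙ T ≅ FrdI.Prop53Sub.iotaRlf F hΦ e) → Nonempty (T ≅ 𝟭 _)) ↔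
      ∀ T : PreFrobenioid.rlf F hΦ ⥤ PreFrobenioid.rlf F hΦ,
        Nonempty (PreFrobenioid.untrToRlf F hΦ ⋙ T ≅ PreFrobenioid.untrToRlf F hΦ) → Nonempty (T ≅ 𝟭 _) := by
  -- `ι = (toUntr ⋙ e.functor) ⋙ untrToRlf`, definitionally up to the associator
  let G := (PreFrobenioidData.ofFunctor Φ F).toUntr ⋙ e.functor
  haveI : G.Full := Functor.Full.comp _ _
  haveI : G.EssSurj := Functor.essSurj_comp _ _
  have hι : FrdI.Prop53Sub.iotaRlf F hΦ e = G ⋙ PreFrobenioid.untrToRlf F hΦ := rfl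
  rw [hι]
  exact ⟨rigidAlong_of_rigidAlong_comp G _, rigidAlong_comp_of_full_essSurj G _⟩

/-- Hence: **the strong clause at the data follows from rigidity along `untrToRlf F₁ hΦ₁` alone** (the form in
which the remaining content — an endofunctor of THE realified model fixing the integral sub-model is `≅ 𝟭` —
is to be attacked). [cite: MochizukiFrdI2008, Cor. 5.4 p.104] -/
theorem strongUnique_of_rigidAlong_untrToRlf [Ψrlf.IsEquivalence] (hsq : Square hΦ₁ hΦ₂ Ψistr e₁ e₂ Ψrlf)
    (hrig : ∀ T : PreFrobenioid.rlf F₁ hΦ₁ ⥤ PreFrobenioid.rlf F₁ hΦ₁,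
      Nonempty (PreFrobenioid.untrToRlf F₁ hΦ₁ ⋙ T ≅ PreFrobenioid.untrToRlf F₁ hΦ₁) → Nonempty (T ≅ 𝟭 _))
    (Ψ' : PreFrobenioid.rlf F₁ hΦ₁ ⥤ PreFrobenioid.rlf F₂ hΦ₂) (hsq' : Square hΦ₁ hΦ₂ Ψistr e₁ e₂ Ψ') :
    Nonempty (Ψ' ≅ Ψrlf) :=
  strongUnique_of_rigidAlong hΦ₁ hΦ₂ Ψistr e₁ e₂ Ψrlf hsq
    ((rigidAlong_iota_iff_rigidAlong_untrToRlf hΦ₁ e₁).2 hrig) Ψ' hsq'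

end AtTheData

end FrdI.Cor54Sub

end Literature.AlgebraicGeometry.Frobenioids

end
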